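import Literature.AlgebraicGeometry.HodgeTheory.SymmetricA3MonodromyRelations
import HarnessLib

/-!
# The `A₃` relations at a symmetric `A₃` point = non-commutation ∧ the `B₂` braid relation (odd fibre dimension)

Family `hodge`, layer `Literature/AlgebraicGeometry/HodgeTheory`; sequel of `SymmetricA3MonodromyRelations` (theorems only, no
definition, no named fact).  Written by the prover seat `hodge-nonav-19716-p2` (g9, cell `hodge-nonav`) for the binder hA3 of crux
K1-B `VeryGeneralSignCommutatorsInHg` (`Summits/HodgeConjecture/HodgeConjecture/Theses/SignSymmetricPowers.lean`,
stmt-HodgeConjecture-19716; registry v19 = {hPL, hCDK, hA3}).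

hA3 (`SymmetricA3MonodromyRelations`) says, for THE rational transports `T₁, T₂` along the two circles of the symmetric `A₃`
unfolding: (N) `T₁T₂ ≠ T₂T₁` and (R) `N₁N₂N₁ = ((−1)ⁿ·2)·N₁`, `Nᵢ = Tᵢ − 1`.  This file splits (R) off as a statement of a
DIFFERENT kind.  With the Picard–Lefschetz pair data (P1)(P2) (transvections for odd `n`: `N₁² = N₂² = 0`) one has the
ring identity (`sq_mul_sub_sq_mul_eq_smul`)
`(T₁T₂)² − (T₂T₁)² = (2 + k)·(T₁T₂ − T₂T₁)` whenever `N₁N₂N₁ = k·N₁`,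
and `k = −I`, `I = c₀²(B(e₁,e₂)² + B(e₃,e₂)²)` (`apply_rel_of_formulas`).  Hence (`trans_sq_eq_iff`): the **`B₂` BRAID RELATION**
`(T₁T₂)² = (T₂T₁)²` holds iff `I = 2` or `T₁T₂ = T₂T₁`; and so, for odd `n` (`symmetricA3MonodromyRelations_iff_nonComm_and_braid`),

  hA3 ⟺ (N) non-commutation ∧ (BRAID) `(T₁T₂)² = (T₂T₁)²` — given the pair data, which hPL supplies (`PicardLefschetzSymmetricA3OfUniform`).

The point of the split: (BRAID) is a statement about the IMAGE OF `π₁` — the two circles generate the fundamental group of the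
complement of the bifurcation curve `b(b − ψ(a)) = 0` (two smooth branches with contact of order two) in a bidisc, which is the
Artin group of type `B₂`, `⟨γ₁, γ₂ | γ₁γ₂γ₁γ₂ = γ₂γ₁γ₂γ₁⟩` (Brieskorn 1971, Sém. Bourbaki 401: the complement of the discriminant of a finite reflection
group has fundamental group the Artin group; Arnold 1978 / AGZV II §5.2–5.3 for the boundary singularities `B_μ`; locally: the
complement of two smooth branches meeting with multiplicity `m` is the `(2,2m)` torus-link complement, `⟨a, b | (ab)^m = (ba)^m⟩`,
Zariski–van Kampen) — PLANE-CURVE TOPOLOGY, no Milnor fibre; whereas (N) («the vanishing cycle of the `σ`-fixed node meets the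
exchanged pair») is the irreducible Milnor-lattice residue.  Nothing here proves (BRAID) or (N); the registry is not changed by this
file (a lossless refinement hA3 = hN ∧ hBRAID is available to the planner).  HC not proved; rung F-H1 not moved.

References: [Brieskorn1973] E. Brieskorn, Sur les groupes de tresses (d'après V. I. Arnol'd), Sém. Bourbaki 401 (1971/72),
LNM 317 (the theorem of Invent. Math. 12 (1971) 57–61: π₁ of the regular orbit space = Artin group); [ArnoldGuseinzadeVarchenko2012] AGZV II, Part I §5.2–§5.3, §2.9 Thm. 2.15;
[Deligne1980] Weil II §4.4 (transvection algebra); [VoisinHodgeII2003] §3.1.2 (monodromy representation), §3.2.1 Thm. 3.16.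
-/

noncomputable section

open CategoryTheory AlgebraicGeometry MvPolynomial
open Literature.AlgebraicTopology.SingularHomology
open Literature.AlgebraicGeometry.Motives Literature.AlgebraicGeometry.Motives.UniversalHypersurface

namespace Literature.AlgebraicGeometry.HodgeTheory

/-! ### §1 The ring identity behind the braid relation -/

section Algebra

variable {K A : Type*} [Field K] [Ring A] [Algebra K A]

/-- **The braid defect of two square-zero elements.**  In any `K`-algebra: if `a² = 0`, `b² = 0` and `aba = k·a`, then
`((1+a)(1+b))² − ((1+b)(1+a))² = (2 + k)·((1+a)(1+b) − (1+b)(1+a))`.  (For the unipotent local monodromies `Tᵢ = 1 + Nᵢ` of a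
two-parameter unfolding: the `B₂` braid relation `(T₁T₂)² = (T₂T₁)²` holds iff `k = −2` or `T₁T₂ = T₂T₁`.)
[cite: Deligne1980, §4.4 Lemme (4.4.3^α) p. 227] -/
theorem sq_mul_sub_sq_mul_eq_smul (a b : A) (k : K) (h1 : a * a = 0) (h2 : b * b = 0) (h3 : a * b * a = k • a) :
    ((1 + a) * (1 + b)) ^ 2 - ((1 + b) * (1 + a)) ^ 2 = (2 + k) • ((1 + a) * (1 + b) - (1 + b) * (1 + a)) := by
  have h4 : a * b * a * b = k • (a * b) := by rw [h3, smul_mul_assoc]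
  have h5 : b * (a * b * a) = k • (b * a) := by rw [h3, mul_smul_comm]
  have E1 : ((1 + a) * (1 + b)) ^ 2 = 1 + a + a + b + b + a * b + a * b + a * b + b * a + a * a + b * b
      + a * a * b + a * (b * b) + b * a * b + a * b * a + a * b * a * b := by noncomm_ring
  have E2 : ((1 + b) * (1 + a)) ^ 2 = 1 + a + a + b + b + b * a + b * a + b * a + a * b + a * a + b * b
      + b * b * a + b * (a * a) + a * b * a + b * a * b + b * (a * b * a) := by noncomm_ring
  have E3 : (1 + a) * (1 + b) - (1 + b) * (1 + a) = a * b - b * a := by noncomm_ring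
  rw [E1, E2, E3, h4, h5, h1, h2, h3]
  simp only [zero_mul, mul_zero, add_zero, add_smul, smul_sub, two_smul]
  abel

end Algebra

/-! ### §2 The braid relation for an `A₃`-shaped pair of Picard–Lefschetz transformations (odd fibre dimension) -/

section HodgeTheory

variable {n d : ℕ} {hn : 1 ≤ n} {hd : 1 ≤ d} {hU : IsCohomologicallyLocallyTrivialOn (family ℂ n d) Set.univ}
  {t₀ : ComplexPoints (base ℂ n d)} {γ₁ γ₂ : Path t₀ t₀} {c₀ : ℚ}
  {e₁ e₂ e₃ : bettiCohomology (fiberOver (family ℂ n d) t₀) n}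
  {T₁ T₂ : bettiCohomology (fiberOver (family ℂ n d) t₀) n ≃ₗ[ℚ] bettiCohomology (fiberOver (family ℂ n d) t₀) n}

/-- **Braid defect of the `A₃` pair** (odd `n`).  For Picard–Lefschetz data `(![e₂]; c₀)` along `γ₁` and `(![e₁, e₃]; c₀)` along
`γ₂` with THE transports `T₁, T₂`: in `End(Hⁿ)`,
`(T₁T₂)² − (T₂T₁)² = (2 − I)·(T₁T₂ − T₂T₁)`, `I = (c₀B(e₁,e₂))² + (c₀B(e₃,e₂))²` (transvections: `Nᵢ² = 0`;
`N₁N₂N₁ = −I·N₁` by `apply_rel_of_formulas`). [cite: Deligne1980, §4.4 Lemme (4.4.3^α) p. 227]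
[cite: VoisinHodgeII2003, §3.2.1 Thm. 3.16 and Cor. 3.17] -/
theorem sq_trans_sub_sq_trans_eq_smul (hodd : Odd n) (h1 : IsPicardLefschetzData n d 1 hn hd hU γ₁ ![e₂] c₀)
    (h2 : IsPicardLefschetzData n d 2 hn hd hU γ₂ ![e₁, e₃] c₀)
    (hT₁ : IsRatTransport (family ℂ n d) n hU (loopClassUniv n d γ₁) T₁)
    (hT₂ : IsRatTransport (family ℂ n d) n hU (loopClassUniv n d γ₂) T₂) :
    (((T₂.trans T₁).trans (T₂.trans T₁) : bettiCohomology (fiberOver (family ℂ n d) t₀) n →ₗ[ℚ]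
        bettiCohomology (fiberOver (family ℂ n d) t₀) n)) - ((T₁.trans T₂).trans (T₁.trans T₂) : _ →ₗ[ℚ] _) =
      (2 - ((c₀ * BettiUniverse.tr ((isSmoothProjectiveFamily_family ℂ hn hd).isSmoothProjective t₀) (n + n)
              (BettiUniverse.cup (fiberOver (family ℂ n d) t₀) n n e₁ e₂)) ^ 2 +
            (c₀ * BettiUniverse.tr ((isSmoothProjectiveFamily_family ℂ hn hd).isSmoothProjective t₀) (n + n)
              (BettiUniverse.cup (fiberOver (family ℂ n d) t₀) n n e₃ e₂)) ^ 2)) •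
        (((T₂.trans T₁ : _ ≃ₗ[ℚ] _) : _ →ₗ[ℚ] _) - ((T₁.trans T₂ : _ ≃ₗ[ℚ] _) : _ →ₗ[ℚ] _)) := by
  -- THE transports are the Picard–Lefschetz ones
  obtain ⟨T₁', hT₁', hT₁x⟩ := h1.2.2.1
  obtain ⟨T₂', hT₂', hT₂x⟩ := h2.2.2.1
  have e1 : T₁' = T₁ := isRatTransport_unique_family hT₁' hT₁
  have e2 : T₂' = T₂ := isRatTransport_unique_family hT₂' hT₂
  rw [e1] at hT₁x
  rw [e2] at hT₂x
  set hX : IsSmoothProjective n (fiberOver (family ℂ n d) t₀) :=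
    (isSmoothProjectiveFamily_family ℂ hn hd).isSmoothProjective t₀ with hXdef
  set Bl : bettiCohomology (fiberOver (family ℂ n d) t₀) n →ₗ[ℚ]
      bettiCohomology (fiberOver (family ℂ n d) t₀) n →ₗ[ℚ] ℚ :=
    (BettiUniverse.cup (fiberOver (family ℂ n d) t₀) n n).compr₂ (BettiUniverse.tr hX (n + n)) with hBl
  have hε : ∀ x y, Bl x y = (-1 : ℚ) ^ n * Bl y x := fun x y => tr_cup_comm hX x y
  have hεodd : ((-1 : ℚ) ^ n) = -1 := hodd.neg_one_pow
  -- the nilpotent parts `a = T₁ − 1`, `b = T₂ − 1`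
  set a : Module.End ℚ (bettiCohomology (fiberOver (family ℂ n d) t₀) n) :=
    (T₁ : _ →ₗ[ℚ] _) - 1 with hadef
  set b : Module.End ℚ (bettiCohomology (fiberOver (family ℂ n d) t₀) n) :=
    (T₂ : _ →ₗ[ℚ] _) - 1 with hbdef
  have ha : ∀ x, a x = (c₀ * Bl x e₂) • e₂ := fun x => by
    change T₁ x - x = _
    rw [hT₁x x, Fin.sum_univ_one, Matrix.cons_val_zero, smul_smul, add_sub_cancel_left]
    rfl
  have hb : ∀ x, b x = (c₀ * Bl x e₁) • e₁ + (c₀ * Bl x e₃) • e₃ := fun x => by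
    change T₂ x - x = _
    rw [hT₂x x, Fin.sum_univ_two, Matrix.cons_val_zero, Matrix.cons_val_one, Matrix.cons_val_zero, smul_add,
      smul_smul, smul_smul, add_sub_cancel_left]
    rfl
  -- isotropy and orthogonality (odd `n`)
  have h22 : Bl e₂ e₂ = 0 := by
    have := h1.odd hodd 0; simp only [Matrix.cons_val_zero] at this; exact this
  have h11 : Bl e₁ e₁ = 0 := by
    have := h2.odd hodd 0; simp only [Matrix.cons_val_zero] at this; exact this
  have h33 : Bl e₃ e₃ = 0 := by
    have := h2.odd hodd 1; simp only [Matrix.cons_val_one, Matrix.cons_val_zero] at this; exact this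
  have h13 : Bl e₁ e₃ = 0 := by
    have := h2.orthogonal (show (0 : Fin 2) ≠ 1 by decide)
    simp only [Matrix.cons_val_zero, Matrix.cons_val_one] at this
    exact this
  have h31 : Bl e₃ e₁ = 0 := by rw [hε, h13, mul_zero]
  have haa : a * a = 0 := by
    ext x
    rw [Module.End.mul_apply, ha, ha, LinearMap.zero_apply, map_smul, LinearMap.smul_apply, h22, smul_eq_mul,
      mul_zero, mul_zero, zero_smul]
  have hbb : b * b = 0 := by
    ext x
    rw [Module.End.mul_apply, hb, hb x, LinearMap.zero_apply]
    simp only [map_add, map_smul, LinearMap.add_apply, LinearMap.smul_apply, smul_eq_mul, h11, h33, h13, h31,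
      mul_zero, add_zero, zero_smul]
  have haba : a * b * a = ((-1 : ℚ) ^ n * ((c₀ * Bl e₁ e₂) ^ 2 + (c₀ * Bl e₃ e₂) ^ 2)) • a := by
    ext x
    rw [Module.End.mul_apply, Module.End.mul_apply, LinearMap.smul_apply]
    exact apply_rel_of_formulas Bl hε ha hb x
  have hid := sq_mul_sub_sq_mul_eq_smul a b _ haa hbb haba
  -- `1 + a = T₁`, `1 + b = T₂`, and `(e.trans f : V →ₗ V) = f * e`
  have h1a : (1 : Module.End ℚ _) + a = (T₁ : _ →ₗ[ℚ] _) := by rw [hadef]; abel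
  have h1b : (1 : Module.End ℚ _) + b = (T₂ : _ →ₗ[ℚ] _) := by rw [hbdef]; abel
  rw [h1a, h1b, hεodd] at hid
  have htr : ∀ (P Q : bettiCohomology (fiberOver (family ℂ n d) t₀) n ≃ₗ[ℚ]
      bettiCohomology (fiberOver (family ℂ n d) t₀) n), ((P.trans Q : _ ≃ₗ[ℚ] _) : _ →ₗ[ℚ] _) =
        (Q : Module.End ℚ (bettiCohomology (fiberOver (family ℂ n d) t₀) n)) *
          (P : Module.End ℚ (bettiCohomology (fiberOver (family ℂ n d) t₀) n)) :=
    fun P Q => rfl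
  rw [htr, htr, htr, htr, ← sq, ← sq, hid]
  congr 1
  simp only [hBl, LinearMap.compr₂_apply]
  ring

/-- **The `B₂` braid relation ⟺ (`I = 2` or commutation)** for the `A₃`-shaped pair (odd `n`): the transports along
`γ₁γ₂γ₁γ₂` and `γ₂γ₁γ₂γ₁` coincide iff `c₀²(B(e₁,e₂)² + B(e₃,e₂)²) = 2` or `T₁T₂ = T₂T₁`.
[cite: Deligne1980, §4.4 Lemme (4.4.3^α) p. 227] [cite: VoisinHodgeII2003, §3.1.2 and §3.2.1 Thm. 3.16] -/
theorem trans_sq_eq_iff (hodd : Odd n) (h1 : IsPicardLefschetzData n d 1 hn hd hU γ₁ ![e₂] c₀)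
    (h2 : IsPicardLefschetzData n d 2 hn hd hU γ₂ ![e₁, e₃] c₀)
    (hT₁ : IsRatTransport (family ℂ n d) n hU (loopClassUniv n d γ₁) T₁)
    (hT₂ : IsRatTransport (family ℂ n d) n hU (loopClassUniv n d γ₂) T₂) :
    (T₁.trans T₂).trans (T₁.trans T₂) = (T₂.trans T₁).trans (T₂.trans T₁) ↔
      ((c₀ * BettiUniverse.tr ((isSmoothProjectiveFamily_family ℂ hn hd).isSmoothProjective t₀) (n + n)
              (BettiUniverse.cup (fiberOver (family ℂ n d) t₀) n n e₁ e₂)) ^ 2 +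
            (c₀ * BettiUniverse.tr ((isSmoothProjectiveFamily_family ℂ hn hd).isSmoothProjective t₀) (n + n)
              (BettiUniverse.cup (fiberOver (family ℂ n d) t₀) n n e₃ e₂)) ^ 2 = 2 ∨
        T₁.trans T₂ = T₂.trans T₁) := by
  have hid := sq_trans_sub_sq_trans_eq_smul hodd h1 h2 hT₁ hT₂
  constructor
  · intro hbr
    have h0 : (((T₂.trans T₁).trans (T₂.trans T₁) : _ ≃ₗ[ℚ] _) : bettiCohomology (fiberOver (family ℂ n d) t₀) n →ₗ[ℚ]
        bettiCohomology (fiberOver (family ℂ n d) t₀) n) - ((T₁.trans T₂).trans (T₁.trans T₂) : _ →ₗ[ℚ] _) = 0 := by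
      rw [hbr, sub_self]
    rw [h0] at hid
    rcases smul_eq_zero.1 hid.symm with h | h
    · exact Or.inl (by linarith)
    · right
      exact (LinearEquiv.toLinearMap_injective (sub_eq_zero.1 h)).symm
  · rintro (h | h)
    · apply LinearEquiv.toLinearMap_injective
      have : (((T₂.trans T₁).trans (T₂.trans T₁) : _ ≃ₗ[ℚ] _) : bettiCohomology (fiberOver (family ℂ n d) t₀) n →ₗ[ℚ]
          bettiCohomology (fiberOver (family ℂ n d) t₀) n) - ((T₁.trans T₂).trans (T₁.trans T₂) : _ →ₗ[ℚ] _) = 0 := by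
        rw [hid, h, sub_self, zero_smul]
      exact (sub_eq_zero.1 this).symm
    · rw [h]

/-! ### §3 hA3 ⟺ non-commutation ∧ braid relation (odd `n`, given the pair data) -/

variable {f₁ g₀ g₂ : MvPolynomial (Fin (n + 2)) ℂ} {ψ : ℂ → ℂ} {εa : ℝ}

/-- **hA3 = hN ∧ hBRAID (odd fibre dimension).**  Given the Picard–Lefschetz pair data on the radius `εa`
(`SymmetricA3PicardLefschetzPair`, supplied by hPL via `symmetricA3PicardLefschetzPair_of_uniform`), the `A₃` operator relations
`SymmetricA3MonodromyRelations` hold iff, for THE transports `T₁, T₂` along the two circles: (N) `T₁T₂ ≠ T₂T₁` and (BRAID)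
`(T₁T₂)² = (T₂T₁)²` — the image in monodromy of the relation `γ₁γ₂γ₁γ₂ = γ₂γ₁γ₂γ₁` of the Artin group of type `B₂`
(fundamental group of the complement of the bifurcation curve). [cite: Brieskorn1973, §1 (π₁ of the complement of the discriminant of a finite Coxeter group is the Artin group; type B₂)]
[cite: ArnoldGuseinzadeVarchenko2012, Part I §5.2 and §2.9 Thm. 2.15] [cite: Deligne1980, §4.4 Lemme (4.4.3^α) p. 227] -/
theorem symmetricA3MonodromyRelations_iff_nonComm_and_braid (hodd : Odd n) (hn : 1 ≤ n) (hd : 1 ≤ d)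
    (hP : SymmetricA3PicardLefschetzPair n d f₁ g₀ g₂ ψ εa) :
    SymmetricA3MonodromyRelations n d f₁ g₀ g₂ ψ εa ↔
      ∀ (hU : IsCohomologicallyLocallyTrivialOn (family ℂ n d) Set.univ)
        (a' : ℂ), ‖a'‖ < εa → a' ≠ 0 →
        ∀ (t₀ : ComplexPoints (base ℂ n d)),
          pointForm ℂ n d t₀ = f₁ + a' • g₂ + (ψ a' / 2) • g₀ →
          ∀ (γ₁ γ₂ : Path t₀ t₀),
            (∀ θ : unitInterval, pointForm ℂ n d (γ₁ θ) =
              f₁ + a' • g₂ + (ψ a' / 2 * Complex.exp (2 * Real.pi * Complex.I * ((θ : ℝ) : ℂ))) • g₀) →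
            (∀ θ : unitInterval, pointForm ℂ n d (γ₂ θ) =
              f₁ + a' • g₂ +
                (ψ a' - ψ a' / 2 * Complex.exp (2 * Real.pi * Complex.I * ((θ : ℝ) : ℂ))) • g₀) →
            ∀ (T₁ T₂ : bettiCohomology (fiberOver (family ℂ n d) t₀) n ≃ₗ[ℚ]
                bettiCohomology (fiberOver (family ℂ n d) t₀) n),
              IsRatTransport (family ℂ n d) n hU (loopClassUniv n d γ₁) T₁ →
              IsRatTransport (family ℂ n d) n hU (loopClassUniv n d γ₂) T₂ →
                T₁.trans T₂ ≠ T₂.trans T₁ ∧ (T₁.trans T₂).trans (T₁.trans T₂) = (T₂.trans T₁).trans (T₂.trans T₁) := by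
  constructor
  · intro hR hU a' ha ha0 t₀ ht₀ γ₁ γ₂ hγ₁ hγ₂ T₁ T₂ hT₁ hT₂
    obtain ⟨hN, hrel⟩ := hR hU a' ha ha0 t₀ ht₀ γ₁ γ₂ hγ₁ hγ₂ T₁ T₂ hT₁ hT₂
    obtain ⟨c₀, e₁, e₂, e₃, h1, h2⟩ := hP hn hd hU a' ha ha0 t₀ ht₀ γ₁ γ₂ hγ₁ hγ₂
    refine ⟨hN, (trans_sq_eq_iff hodd h1 h2 hT₁ hT₂).2 (Or.inl ?_)⟩
    -- `I = 2` from the relation `N₁N₂N₁ = −2N₁` and `N₁ ≠ 0`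
    obtain ⟨T₁', hT₁', hT₁x⟩ := h1.2.2.1
    obtain ⟨T₂', hT₂', hT₂x⟩ := h2.2.2.1
    have e1 : T₁' = T₁ := isRatTransport_unique_family hT₁' hT₁
    have e2 : T₂' = T₂ := isRatTransport_unique_family hT₂' hT₂
    rw [e1] at hT₁x
    rw [e2] at hT₂x
    set hX : IsSmoothProjective n (fiberOver (family ℂ n d) t₀) :=
      (isSmoothProjectiveFamily_family ℂ hn hd).isSmoothProjective t₀ with hXdef
    set Bl : bettiCohomology (fiberOver (family ℂ n d) t₀) n →ₗ[ℚ]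
        bettiCohomology (fiberOver (family ℂ n d) t₀) n →ₗ[ℚ] ℚ :=
      (BettiUniverse.cup (fiberOver (family ℂ n d) t₀) n n).compr₂ (BettiUniverse.tr hX (n + n)) with hBl
    have hε : ∀ x y, Bl x y = (-1 : ℚ) ^ n * Bl y x := fun x y => tr_cup_comm hX x y
    have hε2 : ((-1 : ℚ) ^ n) ^ 2 = 1 := by rw [hodd.neg_one_pow]; norm_num
    have hN₁ : ∀ x, T₁ x - x = (c₀ * Bl x e₂) • e₂ := fun x => by
      rw [hT₁x x, Fin.sum_univ_one, Matrix.cons_val_zero, smul_smul, add_sub_cancel_left]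
      rfl
    have hN₂ : ∀ x, T₂ x - x = (c₀ * Bl x e₁) • e₁ + (c₀ * Bl x e₃) • e₃ := fun x => by
      rw [hT₂x x, Fin.sum_univ_two, Matrix.cons_val_zero, Matrix.cons_val_one, Matrix.cons_val_zero, smul_add,
        smul_smul, smul_smul, add_sub_cancel_left]
      rfl
    have hrel' : ∀ x, (fun x => T₁ x - x) ((fun x => T₂ x - x) ((fun x => T₁ x - x) x)) =
        ((-1 : ℚ) ^ n * 2) • (fun x => T₁ x - x) x := fun x => hrel x
    have hne : ∃ x, (fun x => T₁ x - x) x ≠ 0 := by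
      by_contra h0
      push Not at h0
      apply hN
      have hT1 : T₁ = LinearEquiv.refl ℚ _ := LinearEquiv.ext fun x => by
        have := h0 x; rw [sub_eq_zero] at this; simpa using this
      rw [hT1]; rfl
    exact sum_sq_eq_two_of_rel Bl hε hε2 hN₁ hN₂ hrel' hne
  · intro hB hU a' ha ha0 t₀ ht₀ γ₁ γ₂ hγ₁ hγ₂ T₁ T₂ hT₁ hT₂
    obtain ⟨hN, hbr⟩ := hB hU a' ha ha0 t₀ ht₀ γ₁ γ₂ hγ₁ hγ₂ T₁ T₂ hT₁ hT₂
    obtain ⟨c₀, e₁, e₂, e₃, h1, h2⟩ := hP hn hd hU a' ha ha0 t₀ ht₀ γ₁ γ₂ hγ₁ hγ₂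
    refine ⟨hN, fun x => ?_⟩
    have hI : (c₀ * _) ^ 2 + (c₀ * _) ^ 2 = 2 :=
      ((trans_sq_eq_iff hodd h1 h2 hT₁ hT₂).1 hbr).resolve_right hN
    obtain ⟨T₁', hT₁', hT₁x⟩ := h1.2.2.1
    obtain ⟨T₂', hT₂', hT₂x⟩ := h2.2.2.1
    have e1 : T₁' = T₁ := isRatTransport_unique_family hT₁' hT₁
    have e2 : T₂' = T₂ := isRatTransport_unique_family hT₂' hT₂
    rw [e1] at hT₁x
    rw [e2] at hT₂x
    set hX : IsSmoothProjective n (fiberOver (family ℂ n d) t₀) :=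
      (isSmoothProjectiveFamily_family ℂ hn hd).isSmoothProjective t₀ with hXdef
    set Bl : bettiCohomology (fiberOver (family ℂ n d) t₀) n →ₗ[ℚ]
        bettiCohomology (fiberOver (family ℂ n d) t₀) n →ₗ[ℚ] ℚ :=
      (BettiUniverse.cup (fiberOver (family ℂ n d) t₀) n n).compr₂ (BettiUniverse.tr hX (n + n)) with hBl
    have hε : ∀ x y, Bl x y = (-1 : ℚ) ^ n * Bl y x := fun x y => tr_cup_comm hX x y
    have hN₁ : ∀ x, T₁ x - x = (c₀ * Bl x e₂) • e₂ := fun x => by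
      rw [hT₁x x, Fin.sum_univ_one, Matrix.cons_val_zero, smul_smul, add_sub_cancel_left]
      rfl
    have hN₂ : ∀ x, T₂ x - x = (c₀ * Bl x e₁) • e₁ + (c₀ * Bl x e₃) • e₃ := fun x => by
      rw [hT₂x x, Fin.sum_univ_two, Matrix.cons_val_zero, Matrix.cons_val_one, Matrix.cons_val_zero, smul_add,
        smul_smul, smul_smul, add_sub_cancel_left]
      rfl
    have h := apply_rel_of_formulas Bl hε hN₁ hN₂ x
    have hI' : (c₀ * Bl e₁ e₂) ^ 2 + (c₀ * Bl e₃ e₂) ^ 2 = 2 := hI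
    rw [hI'] at h
    simpa only using h

end HodgeTheory

end Literature.AlgebraicGeometry.HodgeTheory

end
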